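import Mathlib
import HarnessLib
import Summits.AnomalousDissipation.AnomalousDissipation.Theses.LimitingAbsorption
import Literature.Analysis.FluidPDE.PassiveScalar
import Literature.Analysis.FluidPDE.PassiveScalarForced
import Literature.Analysis.FluidPDE.SeisDissipationRateBound

/-!
# Sketch (crux-ideate, ideator 2, round 1) — crux `LimitingAbsorption.UniformRelaxationWitness`
(stmt-AnomalousDissipation-2937)

Typed spine of the idea card `sign-coherent-two-phase-stirring`:

* `RelaxesUniformlyFrom` — the `(U_h)` clause of the crux, with the set of admissible phases as a
  parameter (the crux uses `S = Ici 0`).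
* `SeisSharpBudgetedRelaxer` — FIRST LEMMA (kinematic template at the Seis threshold): a
  bounded-energy, point-symmetric, time-periodic smooth stirring family `w_ν` with enstrophy
  `O(log²(1/ν))` relaxing ONE odd smooth profile `h` `ν`-uniformly from EVERY phase. Seis 2022
  (vendored `Seis2022_rmk1_L2`) says no family with `o(log²)` enstrophy can; the card's two-phase
  architecture is the candidate witness. Open-but-tractable (kinematic), size L.
* `OddSectorPreserved` — symmetry bookkeeping: for a point-symmetric drift and an odd datum every
  weak solution stays odd (uniqueness for bounded drift), hence has zero mean on every
  point-symmetric measurable set — the typed form of "phase parity": the scalar never needs to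
  cross the `±`-vorticity interface to lose its phase means.
* `PeriodicPhaseReduction` — for a time-periodic drift, `(U_h)` from the phases of one period is
  `(U_h)` from every phase (proved below: pure rewriting).
* `RecurrentSymmetricStates` — the TRANSFER `C⁺`: exact time-periodic, point-symmetric, steadily
  forced 2-D Navier–Stokes states with pointwise bounded energy, `(U_h)` over one period and the
  absorption floor; `TransferClaim : C⁺ → UniformRelaxationWitness` (typed; the proof is
  `PeriodicPhaseReduction` + `meanEnergy ≤ sup-energy`, left to crux-plan).
-/

open MeasureTheory Set Filter
open scoped ENNReal NNReal

noncomputable section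

set_option linter.dupNamespace false

namespace Summit.AnomalousDissipation.AnomalousDissipation.Cruxes.UniformRelaxationWitness.Ideator2

open Literature.Analysis.FluidPDE Literature.Analysis.FunctionSpaces

/-- The flat two-torus (local notation). -/
local notation "𝕋²" => UnitAddTorus (Fin 2)
/-- Planar velocity values (local notation). -/
local notation "E²" => EuclideanSpace ℝ (Fin 2)

/-- The `(U_h)` clause of the crux with a parameter `S` = set of admissible release phases:
every weak solution of `∂ₜθ + u(s+·)·∇θ = κΔθ`, `θ(0) = h`, `s ∈ S`, obeys
`‖θ(t)‖² ≤ C e^{-γt} ‖h‖²` for a.e. `t ∈ (0,T)`. The crux is the case `S = Ici 0`. -/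
def RelaxesUniformlyFrom (κ : ℝ) (u : ℝ → 𝕋² → E²) (h : 𝕋² → ℝ) (C γ : ℝ) (S : Set ℝ) : Prop :=
  ∀ s ∈ S, ∀ (T : ℝ) (θ : ℝ → 𝕋² → ℝ),
    Torus.IsWeakScalarTransportOn T κ (fun t => u (s + t)) h θ →
      ∀ᵐ t ∂(volume.restrict (Ioo (0 : ℝ) T)),
        Torus.scalarL2Sq (θ t) ≤ C * Real.exp (-(γ * t)) * Torus.scalarL2Sq h

/-- Readback check: the crux's `(U_h)` conjunct for level `j` is `RelaxesUniformlyFrom` with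
`S = Ici 0` (definitional unfolding; stated as an `iff` over the literal text of the route decl's
inner clause). -/
theorem relaxesUniformlyFrom_ici_iff (κ : ℝ) (u : ℝ → 𝕋² → E²) (h : 𝕋² → ℝ) (C γ : ℝ) :
    RelaxesUniformlyFrom κ u h C γ (Ici 0) ↔
      ∀ s : ℝ, 0 ≤ s → ∀ (T : ℝ) (θ : ℝ → 𝕋² → ℝ),
        Torus.IsWeakScalarTransportOn T κ (fun t => u (s + t)) h θ →
          ∀ᵐ t ∂(volume.restrict (Ioo (0 : ℝ) T)),
            Torus.scalarL2Sq (θ t) ≤ C * Real.exp (-(γ * t)) * Torus.scalarL2Sq h := by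
  simp [RelaxesUniformlyFrom, Set.mem_Ici]

/-- **FIRST LEMMA (kinematic template at the Seis threshold; open, size L).** There is ONE odd
smooth mean-zero profile `h ≠ 0` and constants `C, γ, E, K, T₀` such that for every
`ν ∈ (0, 1/2]` some smooth, divergence-free, mean-zero, `T₀`-periodic, point-symmetric
(`w(t,-x) = -w(t,x)`) stirring field `w_ν` with pointwise energy `≤ E` and pointwise enstrophy
`≤ K log²(1/ν)` relaxes `h` with diffusivity `ν` at the `ν`-UNIFORM exponential rate `(C, γ)` from
EVERY phase. By `Seis2022_rmk1_L2` the budget `log²` cannot be lowered; the card's candidate is the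
two-phase boustrophedon-jet field (vorticity `±K^{1/2} log(1/ν)` on two interdigitated
point-symmetric phases of width `≍ 1/log(1/ν)`, chaotic inside each phase, no fluid exchange across
the interface). -/
def SeisSharpBudgetedRelaxer : Prop :=
  ∃ h : 𝕋² → ℝ, Torus.IsSmooth h ∧ Torus.HasZeroMean h ∧ (∃ x, h x ≠ 0) ∧ (∀ x, h (-x) = -h x) ∧
    ∃ C γ E K T₀ : ℝ, 0 ≤ C ∧ 0 < γ ∧ 0 < T₀ ∧
      ∀ ν : ℝ, 0 < ν → ν ≤ 1 / 2 →
        ∃ w : ℝ → 𝕋² → E²,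
          (∀ t, Torus.IsSmooth (w t)) ∧ (∀ t, Torus.IsDivFree (w t)) ∧
          (∀ t, Torus.HasZeroMean (w t)) ∧
          (∀ T : ℝ, 0 < T →
            MemLp (Torus.stLift w) ⊤ (volume.restrict (Ioo (0 : ℝ) T ×ˢ univ))) ∧
          (∀ t x, w (t + T₀) x = w t x) ∧
          (∀ t x, w t (-x) = -w t x) ∧
          (∀ t, ∫⁻ x, ‖w t x‖ₑ ^ 2 ≤ ENNReal.ofReal E) ∧
          (∀ t, Torus.eGradNormSq (w t) ≤ ENNReal.ofReal (K * Real.log ν⁻¹ ^ 2)) ∧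
          RelaxesUniformlyFrom ν w h C γ (Ici 0)

/-- **Odd sector is preserved (symmetry bookkeeping; size S given uniqueness for bounded drift).**
For `κ > 0`, a bounded point-symmetric drift and an odd datum, every weak solution is odd at
a.e. time; in particular `∫_U θ(t) = 0` for every measurable point-symmetric `U` — the scalar
carries no mean on either vorticity phase, so no cross-interface transport is ever needed. -/
def OddSectorPreserved : Prop :=
  ∀ (κ T : ℝ) (u : ℝ → 𝕋² → E²) (h : 𝕋² → ℝ) (θ : ℝ → 𝕋² → ℝ), 0 < κ →
    (∀ t x, u t (-x) = -u t x) → (∀ x, h (-x) = -h x) →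
    MemLp (Torus.stLift u) ⊤ (volume.restrict (Ioo (0 : ℝ) T ×ˢ univ)) →
    Torus.IsWeakScalarTransportOn T κ u h θ →
      ∀ᵐ t ∂(volume.restrict (Ioo (0 : ℝ) T)),
        (fun x => θ t (-x)) =ᵐ[volume] fun x => -θ t x

/-- **Periodic phase reduction (proved).** For a `T₀`-periodic drift, `(U_h)` from the phases of
one period `[0, T₀]` is `(U_h)` from every phase `s ≥ 0` with the SAME constants: the equation
released at phase `s` is literally the equation released at phase `s mod T₀`. -/
theorem periodicPhaseReduction {κ : ℝ} {u : ℝ → 𝕋² → E²} {h : 𝕋² → ℝ} {C γ T₀ : ℝ}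
    (hT₀ : 0 < T₀) (hper : Function.Periodic u T₀)
    (hU : RelaxesUniformlyFrom κ u h C γ (Icc 0 T₀)) :
    RelaxesUniformlyFrom κ u h C γ (Ici 0) := by
  intro s _ T θ hθ
  -- reduce the phase into the fundamental period
  set s' := toIcoMod hT₀ 0 s with hs'
  have hs'mem : s' ∈ Ico (0 : ℝ) (0 + T₀) := toIcoMod_mem_Ico hT₀ 0 s
  have hshift : (fun t => u (s + t)) = fun t => u (s' + t) := by
    funext t
    have h1 : s' = s - toIcoDiv hT₀ 0 s • T₀ := by
      rw [hs', self_sub_toIcoDiv_zsmul]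
    rw [h1, zsmul_eq_mul]
    have := (hper.int_mul (toIcoDiv hT₀ 0 s)).sub_eq (s + t)
    -- u (s + t - n*T₀) = u (s + t)
    rw [show s - (toIcoDiv hT₀ 0 s : ℝ) * T₀ + t = s + t - (toIcoDiv hT₀ 0 s : ℝ) * T₀ by ring]
    exact this.symm
  have hs'Icc : s' ∈ Icc (0 : ℝ) T₀ := by
    refine ⟨hs'mem.1, ?_⟩
    have := hs'mem.2
    simp at this
    exact this.le
  rw [hshift] at hθ
  exact hU s' hs'Icc T θ hθ

/-- **TRANSFER `C⁺` (where the card says witnesses live).** Exact time-periodic, point-symmetric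
states of the steadily forced 2-D Navier–Stokes equations: a steady smooth solenoidal mean-zero
point-symmetric force `g`, an odd smooth mean-zero profile `h`, `ν_j → 0`, periods
`0 < T_j ≤ T₀`, global Leray–Hopf (in fact classical) solutions `v_j` with `v_j(t + T_j) = v_j(t)`,
`v_j(t,-x) = -v_j(t,x)`, locally bounded, POINTWISE energy `≤ E`, the relaxation clause from the
phases of ONE period with `ν`-uniform `(C, γ)`, and the absorption floor. -/
def RecurrentSymmetricStates : Prop :=
  ∃ (g : 𝕋² → E²) (h : 𝕋² → ℝ), Torus.IsSmooth g ∧ Torus.IsDivFree g ∧ Torus.HasZeroMean g ∧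
    (∀ x, g (-x) = -g x) ∧ Torus.IsSmooth h ∧ Torus.HasZeroMean h ∧ (∀ x, h (-x) = -h x) ∧
    ∃ (ν T : ℕ → ℝ) (T₀ E : ℝ) (v₀ : ℕ → 𝕋² → E²) (v : ℕ → ℝ → 𝕋² → E²),
      (∀ j, 0 < ν j) ∧ Tendsto ν atTop (nhds 0) ∧ (∀ j, 0 < T j ∧ T j ≤ T₀) ∧
      (∀ j, Torus.IsGlobalLerayHopf (ν j) (fun _ => g) (v₀ j) (v j)) ∧
      (∀ j (T' : ℝ), 0 < T' →
        MemLp (Torus.stLift (v j)) ⊤ (volume.restrict (Ioo (0 : ℝ) T' ×ˢ univ))) ∧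
      (∀ j, Function.Periodic (v j) (T j)) ∧
      (∀ j t x, v j t (-x) = -v j t x) ∧
      (∀ j t, 0 ≤ t → ∫⁻ x, ‖v j t x‖ₑ ^ 2 ≤ ENNReal.ofReal E) ∧
      (∃ C γ : ℝ, 0 ≤ C ∧ 0 < γ ∧ ∀ j, RelaxesUniformlyFrom (ν j) (v j) h C γ (Icc 0 (T j))) ∧
      ∃ ε : ℝ, 0 < ε ∧ ∀ j, ∃ θ : ℝ → 𝕋² → ℝ,
        Torus.IsWeakScalarTransportForced (ν j) (v j) (fun _ => h) 0 θ ∧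
        ε ≤ longTimeAvgSup (fun t => ν j * (Torus.eScalarGradNormSq (θ t)).toReal)

/-- The transfer to the crux BY NAME (typed target for crux-plan; proof = `periodicPhaseReduction`
per level + `meanEnergy ≤ E` from the pointwise energy bound via `longTimeAvgSup` monotonicity). -/
def TransferClaim : Prop :=
  RecurrentSymmetricStates →
    Summit.AnomalousDissipation.AnomalousDissipation.Theses.LimitingAbsorption.UniformRelaxationWitness

/-- The relaxation half of the transfer is already formal: periodicity upgrades one-period `(U_h)`
to all phases. -/
theorem relaxation_allPhases_of_recurrent {ν T : ℕ → ℝ} {T₀ : ℝ} {v : ℕ → ℝ → 𝕋² → E²}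
    {h : 𝕋² → ℝ} {C γ : ℝ} (hT : ∀ j, 0 < T j ∧ T j ≤ T₀)
    (hper : ∀ j, Function.Periodic (v j) (T j))
    (hU : ∀ j, RelaxesUniformlyFrom (ν j) (v j) h C γ (Icc 0 (T j))) :
    ∀ j, RelaxesUniformlyFrom (ν j) (v j) h C γ (Ici 0) :=
  fun j => periodicPhaseReduction (hT j).1 (hper j) (hU j)

end Summit.AnomalousDissipation.AnomalousDissipation.Cruxes.UniformRelaxationWitness.Ideator2

end
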